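import Summits.QuantumFields.YangMills.Theorems.UnitScaleTiltFluctuationComparisonRegPrLiftFaceTransport

/-!
# Route `UnitScaleTilt` — crux K1bR-pr `FluctuationComparisonRegPr` (stmt-QuantumFields-19201), stub `stub_oneStepSmallLift`
# (W7 line), piece (L2), layer F5b: THE LINEAR TWISTED COBOUNDARY OF THE KERNEL LIFT IS THE KERNEL'S ROW FUNCTIONAL UP TO `O(δ²)`
# (support file `--supports stmt-QuantumFields-19201`)

Fleet seat `ym-ust-19201-p1` gen 2 (CARD-19201-oneStepSmallLift-L1L2 §2).  For the kernel lift `U⋆_V = exp(ζ_V)·faceSec V` of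
`…LiftFaceKernel` and a fine plaquette `p = ⟨x, μ, ν⟩`, `y = blockOf x`:

* §1 the four `faceSec`-transports on `∂p` (`W₁`, `W₁W₂W₃⁻¹`, `W(∂p)`) are holonomies of `V` along explicit coarse words from `y` of length
  `≤ 4` (`faceSec_eq_holAt_word₁`, `faceSec_transport₃_eq_holAt`, `plaqHol_faceSec_eq_holAt`), whose integer net displacements are the
  block shifts `s₂ = [x exits in μ]·e_μ`, `s₃ = [x exits in ν]·e_ν`, `0`; the blocks of the four bond sources (`blockOf_shift`).
* §2 `wlogZ V y o m = Ad_{V(Γ¹_{y,y+m})} log V(∂(o; y+m))` (integer-indexed transported logarithms) and the **UNIFICATION STEP**: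
  `‖Ad_{V(ω)} wlogZ V (y+s) o m − wlogZ V y o (s+m)‖ ≤ ℓ²·δ·(2δ)`-type bound for a word `ω` of net displacement `s` (layer F5a).
* §3 **`norm_linZeta_sub_rowForm_le`**: `‖linZeta p − Φ_p(wlogZ V y)‖ ≤ C(K₁,R,d)·δ²`, where the ROW FORM
  `Φ_p(w) = Σ_k σ_k Σ_{o,k′} kz(a_k, pp_k, o, k′) • w(o, s_k + k′ − R)` depends on `p` only through its class `(μ, ν, offs x)`.

Layers F5c/F6 (row bound modulo `∂`, Bianchi) close the plaquette clause.  Elementary; nothing of Bałaban's is asserted.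
-/

noncomputable section

open scoped BigOperators Matrix.Norms.L2Operator
open NormedSpace

namespace Summit.QuantumFields.YangMills.Theorems.ApproxLift

open Literature.MathematicalPhysics.QuantumFieldTheory.Balaban1983to89
open T4Continuum BlockAveraging AveragingRT B10Eq47AxialChi BlockAveragingSection BlockAveragingSectionPlaq ExpMeanLog MatrixLog

variable {P : Params} {j : ℕ}

/-! ## §1 The `faceSec` transports on `∂p` as holonomies of short coarse words -/

section Words

variable {G : Type*} [GaugeGroup G]

/-- The optional one-letter word `[±a]` or `[]`. -/
def optLetter {d : ℕ} (b : Bool) (a : Fin d) (fwd : Bool) : List (Letter d) := if b then [(a, fwd)] else []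

/-- Net displacement of the optional letter. -/
theorem netDisp_optLetter {d : ℕ} (b : Bool) (a : Fin d) (fwd : Bool) (κ : Fin d) :
    netDisp (optLetter b a fwd) κ = if b then (if a = κ then (if fwd then 1 else -1) else 0) else 0 := by
  unfold optLetter netDisp
  cases b <;> cases fwd <;> by_cases h : a = κ <;> simp [h]

/-- Length of the optional letter. -/
theorem length_optLetter {d : ℕ} (b : Bool) (a : Fin d) (fwd : Bool) : (optLetter b a fwd).length ≤ 1 := by
  unfold optLetter; cases b <;> simp

/-- The exit indicator of `x` in direction `a` as a Boolean. -/
def exb (x : Site P j) (a : Fin P.d) : Bool := decide (offset x a = P.L - 1)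

/-- `exb = true ↔ offset = L − 1`. -/
theorem exb_eq_true_iff (x : Site P j) (a : Fin P.d) : exb x a = true ↔ offset x a = P.L - 1 := by
  unfold exb; exact decide_eq_true_iff

/-- `(x + e_a) − e_a = x`. -/
private theorem unshift_shift' (x : Site P (j + 1)) (a : Fin P.d) : (x.shift a).unshift a = x := by
  funext i
  by_cases h : i = a
  · subst h; simp [Site.shift, Site.unshift]
  · simp [Site.shift, Site.unshift, h]
/-- `(x + e_a) + e_b = (x + e_b) + e_a`. -/
private theorem shift_shift_comm' (x : Site P (j + 1)) (a b : Fin P.d) : (x.shift a).shift b = (x.shift b).shift a := by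
  funext i
  by_cases ha : i = a <;> by_cases hb : i = b
  · subst ha; subst hb; rfl
  · subst ha; simp [Site.shift, hb]
  · subst hb; simp [Site.shift, ha]
  · simp [Site.shift, ha, hb]
/-- **`W₁ = faceSec V ⟨x, μ⟩` IS THE HOLONOMY OF THE WORD `[+μ]^{[x exits in μ]}` FROM `y = blockOf x`.** -/
theorem faceSec_eq_holAt_word₁ (V : GaugeField P (j + 1) G) (x : Site P j) (μ : Fin P.d) :
    faceSec V ⟨x, μ⟩ = holAt V (walk (blockOf x) (optLetter (exb x μ) μ true)) := by
  unfold optLetter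
  by_cases h : offset x μ = P.L - 1
  · have hb : exb x μ = true := (exb_eq_true_iff x μ).mpr h
    rw [hb, if_pos rfl, faceSec_of_exits V ((exitsBlock_iff _).mpr h)]
    simp [walk, holAt_cons, holAt_nil]
  · have hb : exb x μ = false := by simpa [exb] using h
    rw [hb, faceSec_of_not_exits V (fun h' => h ((exitsBlock_iff _).mp h'))]
    simp [walk, holAt_nil]
/-- The word `[+μ]^{e_μ} ++ [+ν]^{e_ν} ++ [−μ]^{e_μ}` (transport `W₁W₂W₃⁻¹`). -/
def word₃ (x : Site P j) (μ ν : Fin P.d) : List (Letter P.d) :=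
  optLetter (exb x μ) μ true ++ optLetter (exb x ν) ν true ++ optLetter (exb x μ) μ false
/-- The word `[+μ]^{e_μ} ++ [+ν]^{e_ν} ++ [−μ]^{e_μ} ++ [−ν]^{e_ν}` (transport `W(∂p)`). -/
def word₄ (x : Site P j) (μ ν : Fin P.d) : List (Letter P.d) :=
  optLetter (exb x μ) μ true ++ optLetter (exb x ν) ν true ++ optLetter (exb x μ) μ false ++ optLetter (exb x ν) ν false
/-- **`W₁W₂W₃⁻¹` IS THE HOLONOMY OF `word₃`** (`W = faceSec V`, `μ ≠ ν`, standing range). -/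
theorem faceSec_transport₃_eq_holAt (hj : j + 1 ≤ P.m + P.K) (V : GaugeField P (j + 1) G) (x : Site P j) {μ ν : Fin P.d}
    (hμν : μ ≠ ν) :
    faceSec V ⟨x, μ⟩ * faceSec V ⟨x.shift μ, ν⟩ * (faceSec V ⟨x.shift ν, μ⟩)⁻¹ = holAt V (walk (blockOf x) (word₃ x μ ν)) := by
  have e2 : ExitsBlock (⟨x.shift μ, ν⟩ : PBond P j) ↔ offset x ν = P.L - 1 := (exitsBlock_shift_ne x hμν.symm).trans (exitsBlock_iff _)
  have e3 : ExitsBlock (⟨x.shift ν, μ⟩ : PBond P j) ↔ offset x μ = P.L - 1 := (exitsBlock_shift_ne x hμν).trans (exitsBlock_iff _)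
  unfold word₃ optLetter
  by_cases hμ : offset x μ = P.L - 1 <;> by_cases hν : offset x ν = P.L - 1
  · have hbμ : exb x μ = true := (exb_eq_true_iff x μ).mpr hμ
    have hbν : exb x ν = true := (exb_eq_true_iff x ν).mpr hν
    rw [hbμ, hbν, faceSec_of_exits V ((exitsBlock_iff _).mpr hμ), faceSec_of_exits V (e2.mpr hν), faceSec_of_exits V (e3.mpr hμ)]
    show V ⟨blockOf x, μ⟩ * V ⟨blockOf (x.shift μ), ν⟩ * (V ⟨blockOf (x.shift ν), μ⟩)⁻¹ = _
    rw [blockOf_shift hj x μ, if_pos hμ, blockOf_shift hj x ν, if_pos hν]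
    simp [walk, holAt_cons, holAt_nil, shift_shift_comm' (blockOf x) μ ν, unshift_shift', mul_assoc]
  · have hbμ : exb x μ = true := (exb_eq_true_iff x μ).mpr hμ
    have hbν : exb x ν = false := by simpa [exb] using hν
    rw [hbμ, hbν, faceSec_of_exits V ((exitsBlock_iff _).mpr hμ), faceSec_of_not_exits V (fun h => hν (e2.mp h)),
      faceSec_of_exits V (e3.mpr hμ)]
    show V ⟨blockOf x, μ⟩ * 1 * (V ⟨blockOf (x.shift ν), μ⟩)⁻¹ = _
    rw [blockOf_shift hj x ν, if_neg hν]
    simp [walk, holAt_cons, holAt_nil, unshift_shift']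
  · have hbμ : exb x μ = false := by simpa [exb] using hμ
    have hbν : exb x ν = true := (exb_eq_true_iff x ν).mpr hν
    rw [hbμ, hbν, faceSec_of_not_exits V (fun h => hμ ((exitsBlock_iff _).mp h)), faceSec_of_exits V (e2.mpr hν),
      faceSec_of_not_exits V (fun h => hμ (e3.mp h))]
    show 1 * V ⟨blockOf (x.shift μ), ν⟩ * 1⁻¹ = _
    rw [blockOf_shift hj x μ, if_neg hμ]
    simp [walk, holAt_cons, holAt_nil]
  · have hbμ : exb x μ = false := by simpa [exb] using hμ
    have hbν : exb x ν = false := by simpa [exb] using hν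
    rw [hbμ, hbν, faceSec_of_not_exits V (fun h => hμ ((exitsBlock_iff _).mp h)), faceSec_of_not_exits V (fun h => hν (e2.mp h)),
      faceSec_of_not_exits V (fun h => hμ (e3.mp h))]
    simp [walk, holAt_nil]
/-- **`W(∂p)` IS THE HOLONOMY OF `word₄`** (`W = faceSec V`, `p = ⟨x, μ, ν⟩`, standing range). -/
theorem plaqHol_faceSec_eq_holAt (hj : j + 1 ≤ P.m + P.K) (V : GaugeField P (j + 1) G) (p : Plaq P j) :
    GaugeField.plaqHol (faceSec V) p = holAt V (walk (blockOf p.src) (word₄ p.src p.μ p.ν)) := by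
  rw [plaqHol_faceSec hj V p]
  unfold word₄ optLetter
  by_cases hμ : offset p.src p.μ = P.L - 1 <;> by_cases hν : offset p.src p.ν = P.L - 1
  · have hbμ : exb p.src p.μ = true := (exb_eq_true_iff _ _).mpr hμ
    have hbν : exb p.src p.ν = true := (exb_eq_true_iff _ _).mpr hν
    rw [if_pos ⟨hμ, hν⟩, hbμ, hbν]
    unfold GaugeField.plaqHol
    simp [walk, holAt_cons, holAt_nil, shift_shift_comm' (blockOf p.src) p.μ p.ν, unshift_shift', mul_assoc]
  · have hbμ : exb p.src p.μ = true := (exb_eq_true_iff _ _).mpr hμ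
    have hbν : exb p.src p.ν = false := by simpa [exb] using hν
    rw [if_neg (fun h => hν h.2), hbμ, hbν]
    simp [walk, holAt_cons, holAt_nil, unshift_shift']
  · have hbμ : exb p.src p.μ = false := by simpa [exb] using hμ
    have hbν : exb p.src p.ν = true := (exb_eq_true_iff _ _).mpr hν
    rw [if_neg (fun h => hμ h.1), hbμ, hbν]
    simp [walk, holAt_cons, holAt_nil, unshift_shift']
  · have hbμ : exb p.src p.μ = false := by simpa [exb] using hμ
    have hbν : exb p.src p.ν = false := by simpa [exb] using hν
    rw [if_neg (fun h => hμ h.1), hbμ, hbν]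
    simp [walk, holAt_nil]

end Words


/-! ## §2 Integer-indexed transported logarithms and the unification step -/

section Unify

variable {n : Type*} [Fintype n] [DecidableEq n] [Nonempty n]
/-- `vadd` composes additively. -/
theorem vadd_vadd (y : Site P (j + 1)) (s m : Fin P.d → ℤ) : vadd (vadd y s) m = vadd y (s + m) := by
  funext i; simp only [vadd, Pi.add_apply]; push_cast; ring
/-- `plaqAt (y + s) m = plaqAt y (s + m)`. -/
theorem plaqAt_vadd (y : Site P (j + 1)) (s m : Fin P.d → ℤ) (o : Orient P.d) : plaqAt (vadd y s) m o = plaqAt y (s + m) o := by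
  unfold plaqAt; rw [vadd_vadd]
/-- The end of a walk is the start displaced by the net displacement. -/
theorem walkEnd_eq_vadd (y : Site P (j + 1)) (ω : List (Letter P.d)) : walkEnd y ω = vadd y fun ν => netDisp ω ν := by
  funext ν; rw [walkEnd_apply]; rfl
/-- **THE TRANSPORTED LOGARITHM, INTEGER-INDEXED**: `wlogZ V y o m = Ad_{V(Γ¹_{y,y+m})} log V(∂(o; y+m))` (`wlog R V y o k = wlogZ V y o (k − R)`). -/
def wlogZ (V : GaugeField P (j + 1) (Matrix.specialUnitaryGroup n ℂ)) (y : Site P (j + 1)) (o : Orient P.d) (m : Fin P.d → ℤ) :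
    Matrix n n ℂ :=
  conjM (ctrans V y m) (clog V (plaqAt y m o))
/-- `wlog = wlogZ ∘ kvec`. -/
theorem wlog_eq_wlogZ (R : ℕ) (V : GaugeField P (j + 1) (Matrix.specialUnitaryGroup n ℂ)) (y : Site P (j + 1)) (o : Orient P.d)
    (k : Fin P.d → Fin (2 * R + 1)) : wlog R V y o k = wlogZ V y o (kvec R k) := rfl
/-- `‖wlogZ‖ ≤ 2δ`. -/
theorem norm_wlogZ_le {δ : ℝ} {V : GaugeField P (j + 1) (Matrix.specialUnitaryGroup n ℂ)} (hV : PlaqSmall δ V) (hδ : δ ≤ 1 / 2)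
    (y : Site P (j + 1)) (o : Orient P.d) (m : Fin P.d → ℤ) : ‖wlogZ V y o m‖ ≤ 2 * δ :=
  (norm_conjM_le _ _).trans (norm_clog_le hV hδ _)

/-- A bound `ℓ` on the word length gives `((ℓ′)²/4)δ ≤ (ℓ²/4)δ`-monotonicity. -/
private theorem stokes_mono {a b : ℕ} (h : a ≤ b) {δ : ℝ} (hδ : 0 ≤ δ) : (((a : ℕ) : ℝ) ^ 2 / 4) * δ ≤ (((b : ℕ) : ℝ) ^ 2 / 4) * δ := by
  have : ((a : ℕ) : ℝ) ≤ ((b : ℕ) : ℝ) := by exact_mod_cast h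
  have ha : (0 : ℝ) ≤ ((a : ℕ) : ℝ) := Nat.cast_nonneg _
  exact mul_le_mul_of_nonneg_right (by gcongr) hδ

/-- **THE UNIFICATION STEP**: transporting `wlogZ V (y+s) o m` back to `y` along a word `ω` of integer net displacement `s` and length `≤ 4`
gives `wlogZ V y o (s+m)` up to `2·((4 + d·N + d·(N+1))²/4)·δ·(2δ)`, `|m|∞ ≤ N`, `|s|∞ ≤ 1`, on a `δ`-small `V`. -/
theorem norm_conjM_wlogZ_sub_le {δ : ℝ} (hδ0 : 0 ≤ δ) {V : GaugeField P (j + 1) (Matrix.specialUnitaryGroup n ℂ)} (hV : PlaqSmall δ V)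
    (hδ : δ ≤ 1 / 2) (y : Site P (j + 1)) (ω : List (Letter P.d)) (s : Fin P.d → ℤ) (hω : ∀ ν, netDisp ω ν = s ν)
    (hlen : ω.length ≤ 4) (hs : ∀ i, (s i).natAbs ≤ 1) (o : Orient P.d) (m : Fin P.d → ℤ) (N : ℕ) (hm : ∀ i, (m i).natAbs ≤ N) :
    ‖conjM (holAt V (walk y ω)) (wlogZ V (vadd y s) o m) - wlogZ V y o (s + m)‖ ≤
      2 * ((((4 + P.d * N + P.d * (N + 1) : ℕ) : ℝ) ^ 2 / 4) * δ) * (2 * δ) := by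
  have hend : walkEnd y ω = vadd y s := by rw [walkEnd_eq_vadd]; congr 1; funext ν; exact hω ν
  have h1 : conjM (holAt V (walk y ω)) (wlogZ V (vadd y s) o m) =
      conjM (holAt V (walk y (ω ++ stairWord 1 m))) (clog V (plaqAt y (s + m) o)) := by
    unfold wlogZ ctrans
    rw [← conjM_mul, walk_append, holAt_append, hend, plaqAt_vadd]
  have h2 : wlogZ V y o (s + m) = conjM (holAt V (walk y (stairWord 1 (s + m)))) (clog V (plaqAt y (s + m) o)) := rfl
  rw [h1, h2]
  have hnet : ∀ ν, netDisp (ω ++ stairWord 1 m) ν = netDisp (stairWord 1 (s + m)) ν := fun ν => by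
    rw [T4ReflectionCone.netDisp_append, netDisp_stairWord, netDisp_stairWord, hω ν, Pi.add_apply]
  refine (norm_conjM_holAt_sub_le hδ0 hV y _ _ hnet _).trans ?_
  have hl1 : (ω ++ stairWord 1 m).length ≤ 4 + P.d * N := by
    rw [List.length_append]
    exact add_le_add hlen (LatticeWordStokes.length_stairWord_le 1 m N hm)
  have hl2 : (stairWord (1 : Equiv.Perm (Fin P.d)) (s + m)).length ≤ P.d * (N + 1) :=
    LatticeWordStokes.length_stairWord_le 1 (s + m) (N + 1) fun i => by
      have := hs i; have := hm i; simp only [Pi.add_apply]; omega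
  have hl : (ω ++ stairWord 1 m).length + (stairWord (1 : Equiv.Perm (Fin P.d)) (s + m)).length ≤ 4 + P.d * N + P.d * (N + 1) := by
    omega
  exact mul_le_mul (mul_le_mul_of_nonneg_left (stokes_mono hl hδ0) (by norm_num)) (norm_clog_le hV hδ _) (norm_nonneg _)
    (by positivity)

end Unify


/-! ## §3 The row form of the linear twisted coboundary -/

section RowForm

variable {n : Type*} [Fintype n] [DecidableEq n] [Nonempty n]
variable {R : ℕ} {kz : Fin P.d → (Fin P.d → Fin P.L) → Orient P.d → (Fin P.d → Fin (2 * R + 1)) → ℝ}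

/-- The block-shift vector `[b]·e_a`. -/
def bvec {d : ℕ} (b : Bool) (a : Fin d) : Fin d → ℤ := fun i => if b = true ∧ i = a then 1 else 0

/-- `|kvec R k|∞ ≤ R`. -/
theorem natAbs_kvec_le (R : ℕ) {d : ℕ} (k : Fin d → Fin (2 * R + 1)) (i : Fin d) : (kvec R k i).natAbs ≤ R := by
  unfold kvec; have := (k i).isLt; omega

/-- `|bvec b a|∞ ≤ 1`. -/
theorem natAbs_bvec_le {d : ℕ} (b : Bool) (a : Fin d) (i : Fin d) : (bvec b a i).natAbs ≤ 1 := by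
  unfold bvec; split_ifs <;> simp

/-- `y + [b]·e_a` is `y + e_a` or `y`. -/
theorem vadd_bvec (y : Site P (j + 1)) (b : Bool) (a : Fin P.d) : vadd y (bvec b a) = if b = true then y.shift a else y := by
  funext i
  unfold vadd bvec
  cases b
  · simp
  · by_cases h : i = a
    · subst h; simp [Site.shift]
    · simp [Site.shift, h]

/-- **THE BLOCK OF A SHIFTED SITE AS A DISPLACEMENT**: `blockOf (x + e_a) = blockOf x + [x exits in a]·e_a` (standing range). -/
theorem blockOf_shift_eq_vadd (hj : j + 1 ≤ P.m + P.K) (x : Site P j) (a : Fin P.d) :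
    blockOf (x.shift a) = vadd (blockOf x) (bvec (exb x a) a) := by
  rw [blockOf_shift hj x a, vadd_bvec]
  by_cases h : offset x a = P.L - 1
  · rw [if_pos h, if_pos ((exb_eq_true_iff x a).mpr h)]
  · rw [if_neg h, if_neg (fun h' => h ((exb_eq_true_iff x a).mp h'))]

/-- Net displacement of `word₃`: the `μ`-letters cancel, `[x exits in ν]·e_ν` remains. -/
theorem netDisp_word₃ (x : Site P j) {μ ν : Fin P.d} (κ : Fin P.d) : netDisp (word₃ x μ ν) κ = bvec (exb x ν) ν κ := by
  unfold word₃ bvec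
  rw [T4ReflectionCone.netDisp_append, T4ReflectionCone.netDisp_append, netDisp_optLetter, netDisp_optLetter, netDisp_optLetter]
  cases exb x μ <;> cases exb x ν <;> by_cases h1 : μ = κ <;> by_cases h2 : ν = κ <;> simp [h1, h2, eq_comm]

/-- Net displacement of `word₄`: zero. -/
theorem netDisp_word₄ (x : Site P j) {μ ν : Fin P.d} (κ : Fin P.d) : netDisp (word₄ x μ ν) κ = 0 := by
  unfold word₄
  rw [T4ReflectionCone.netDisp_append, T4ReflectionCone.netDisp_append, T4ReflectionCone.netDisp_append, netDisp_optLetter,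
    netDisp_optLetter, netDisp_optLetter, netDisp_optLetter]
  cases exb x μ <;> cases exb x ν <;> by_cases h1 : μ = κ <;> by_cases h2 : ν = κ <;> simp [h1, h2]

/-- Net displacement of the one-letter word of `W₁`. -/
theorem netDisp_word₁ (x : Site P j) (μ κ : Fin P.d) : netDisp (optLetter (exb x μ) μ true) κ = bvec (exb x μ) μ κ := by
  rw [netDisp_optLetter]; unfold bvec
  cases exb x μ <;> by_cases h1 : μ = κ <;> simp [h1, eq_comm]

/-- Lengths: `|word₃| ≤ 4`, `|word₄| ≤ 4`, `|word₁| ≤ 4`. -/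
theorem length_word₃_le (x : Site P j) (μ ν : Fin P.d) : (word₃ x μ ν).length ≤ 4 := by
  unfold word₃; simp only [List.length_append]
  linarith [length_optLetter (exb x μ) μ true, length_optLetter (exb x ν) ν true, length_optLetter (exb x μ) μ false]
/-- `|word₄| ≤ 4`. -/
theorem length_word₄_le (x : Site P j) (μ ν : Fin P.d) : (word₄ x μ ν).length ≤ 4 := by
  unfold word₄; simp only [List.length_append]
  linarith [length_optLetter (exb x μ) μ true, length_optLetter (exb x ν) ν true, length_optLetter (exb x μ) μ false,
    length_optLetter (exb x ν) ν false]

/-- The uniform second-order size of one unification step at radius `R`: `2·((4 + dR + d(R+1))²/4)·δ·(2δ)`. -/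
def unifB (P : Params) (R : ℕ) (δ : ℝ) : ℝ := 2 * ((((4 + P.d * R + P.d * (R + 1) : ℕ) : ℝ) ^ 2 / 4) * δ) * (2 * δ)

/-- `ζ` at a bond as a `wlogZ`-sum (definitional). -/
theorem zeta_eq_sum_wlogZ (V : GaugeField P (j + 1) (Matrix.specialUnitaryGroup n ℂ)) (b : PBond P j) :
    zeta R kz V b = ∑ o : Orient P.d, ∑ k : Fin P.d → Fin (2 * R + 1),
      ((kz b.dir (offs b.src) o k : ℝ) : ℂ) • wlogZ V (blockOf b.src) o (kvec R k) := rfl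

/-- **TRANSPORTING A KERNEL SUM BACK TO `y`** costs `(Σ|coefficients|)·unifB`. -/
theorem norm_conjM_kernelSum_sub_le {δ : ℝ} (hδ0 : 0 ≤ δ) {V : GaugeField P (j + 1) (Matrix.specialUnitaryGroup n ℂ)}
    (hV : PlaqSmall δ V) (hδ : δ ≤ 1 / 2) (y : Site P (j + 1)) (ω : List (Letter P.d)) (s : Fin P.d → ℤ)
    (hω : ∀ ν, netDisp ω ν = s ν) (hlen : ω.length ≤ 4) (hs : ∀ i, (s i).natAbs ≤ 1)
    (c : Orient P.d → (Fin P.d → Fin (2 * R + 1)) → ℝ) :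
    ‖conjM (holAt V (walk y ω)) (∑ o : Orient P.d, ∑ k : Fin P.d → Fin (2 * R + 1), ((c o k : ℝ) : ℂ) • wlogZ V (vadd y s) o (kvec R k)) -
        ∑ o : Orient P.d, ∑ k : Fin P.d → Fin (2 * R + 1), ((c o k : ℝ) : ℂ) • wlogZ V y o (s + kvec R k)‖ ≤
      (∑ o : Orient P.d, ∑ k : Fin P.d → Fin (2 * R + 1), |c o k|) * unifB P R δ := by
  rw [conjM_sum, ← Finset.sum_sub_distrib]
  simp_rw [conjM_sum, ← Finset.sum_sub_distrib, conjM_smul, ← smul_sub]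
  rw [Finset.sum_mul]
  refine (norm_sum_le _ _).trans (Finset.sum_le_sum fun o _ => ?_)
  rw [Finset.sum_mul]
  refine (norm_sum_le _ _).trans (Finset.sum_le_sum fun k _ => ?_)
  rw [norm_smul, Complex.norm_real, Real.norm_eq_abs]
  exact mul_le_mul_of_nonneg_left (norm_conjM_wlogZ_sub_le hδ0 hV hδ y ω s hω hlen hs o _ R (natAbs_kvec_le R k)) (abs_nonneg _)

/-- **THE ROW FORM** of the class of the fine plaquette `⟨x, μ, ν⟩` applied to an orientation/displacement-indexed matrix field `w` based at
`blockOf x`: the four kernel rows of the bonds of `∂p`, with the block shifts of bonds 2 and 3, signs `(+,+,−,−)`. -/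
def rowForm (R : ℕ) (kz : Fin P.d → (Fin P.d → Fin P.L) → Orient P.d → (Fin P.d → Fin (2 * R + 1)) → ℝ) (x : Site P j)
    (μ ν : Fin P.d) (w : Orient P.d → (Fin P.d → ℤ) → Matrix n n ℂ) : Matrix n n ℂ :=
  (∑ o : Orient P.d, ∑ k : Fin P.d → Fin (2 * R + 1), ((kz μ (offs x) o k : ℝ) : ℂ) • w o (kvec R k)) +
  (∑ o : Orient P.d, ∑ k : Fin P.d → Fin (2 * R + 1), ((kz ν (offs (x.shift μ)) o k : ℝ) : ℂ) • w o (bvec (exb x μ) μ + kvec R k)) -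
  (∑ o : Orient P.d, ∑ k : Fin P.d → Fin (2 * R + 1), ((kz μ (offs (x.shift ν)) o k : ℝ) : ℂ) • w o (bvec (exb x ν) ν + kvec R k)) -
  (∑ o : Orient P.d, ∑ k : Fin P.d → Fin (2 * R + 1), ((kz ν (offs x) o k : ℝ) : ℂ) • w o (kvec R k))

/-- **THE LINEAR TWISTED COBOUNDARY OF THE KERNEL LIFT IS ITS ROW FORM UP TO `3K₁·unifB`** (the three transported bonds each cost one
unification step; standing range, `δ`-small `V`, row mass `≤ K₁`). -/
theorem norm_linZeta_sub_rowForm_le (hj : j + 1 ≤ P.m + P.K) {δ K₁ : ℝ} (hδ0 : 0 ≤ δ)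
    {V : GaugeField P (j + 1) (Matrix.specialUnitaryGroup n ℂ)} (hV : PlaqSmall δ V) (hδ : δ ≤ 1 / 2) (hK : RowMass R kz K₁)
    (p : Plaq P j) :
    ‖linZeta R kz V (faceSec V) p - rowForm R kz p.src p.μ p.ν (wlogZ V (blockOf p.src))‖ ≤ 3 * K₁ * unifB P R δ := by
  have hμν : p.μ ≠ p.ν := ne_of_lt p.hμν
  have hU0 : 0 ≤ unifB P R δ := by unfold unifB; positivity
  set y := blockOf p.src with hy
  have h2 := norm_conjM_kernelSum_sub_le (R := R) hδ0 hV hδ y (optLetter (exb p.src p.μ) p.μ true) (bvec (exb p.src p.μ) p.μ)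
    (netDisp_word₁ p.src p.μ) ((length_optLetter _ _ _).trans (by norm_num)) (natAbs_bvec_le _ _)
    (fun o k => kz p.ν (offs (p.src.shift p.μ)) o k)
  have h3 := norm_conjM_kernelSum_sub_le (R := R) hδ0 hV hδ y (word₃ p.src p.μ p.ν) (bvec (exb p.src p.ν) p.ν)
    (netDisp_word₃ p.src) (length_word₃_le _ _ _) (natAbs_bvec_le _ _) (fun o k => kz p.μ (offs (p.src.shift p.ν)) o k)
  have h4 := norm_conjM_kernelSum_sub_le (R := R) hδ0 hV hδ y (word₄ p.src p.μ p.ν) 0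
    (fun ν => by rw [netDisp_word₄]; rfl) (length_word₄_le _ _ _) (fun i => by simp) (fun o k => kz p.ν (offs p.src) o k)
  have e1 : zeta R kz V ⟨p.src, p.μ⟩ =
      ∑ o : Orient P.d, ∑ k : Fin P.d → Fin (2 * R + 1), ((kz p.μ (offs p.src) o k : ℝ) : ℂ) • wlogZ V y o (kvec R k) := rfl
  have e2 : conjM (faceSec V ⟨p.src, p.μ⟩) (zeta R kz V ⟨p.src.shift p.μ, p.ν⟩) =
      conjM (holAt V (walk y (optLetter (exb p.src p.μ) p.μ true)))
        (∑ o : Orient P.d, ∑ k : Fin P.d → Fin (2 * R + 1),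
          ((kz p.ν (offs (p.src.shift p.μ)) o k : ℝ) : ℂ) • wlogZ V (vadd y (bvec (exb p.src p.μ) p.μ)) o (kvec R k)) := by
    rw [faceSec_eq_holAt_word₁, zeta_eq_sum_wlogZ, blockOf_shift_eq_vadd hj]
  have e3 : conjM (faceSec V ⟨p.src, p.μ⟩ * faceSec V ⟨p.src.shift p.μ, p.ν⟩ * (faceSec V ⟨p.src.shift p.ν, p.μ⟩)⁻¹)
      (zeta R kz V ⟨p.src.shift p.ν, p.μ⟩) =
      conjM (holAt V (walk y (word₃ p.src p.μ p.ν)))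
        (∑ o : Orient P.d, ∑ k : Fin P.d → Fin (2 * R + 1),
          ((kz p.μ (offs (p.src.shift p.ν)) o k : ℝ) : ℂ) • wlogZ V (vadd y (bvec (exb p.src p.ν) p.ν)) o (kvec R k)) := by
    rw [faceSec_transport₃_eq_holAt hj V p.src hμν, zeta_eq_sum_wlogZ, blockOf_shift_eq_vadd hj]
  have e4 : conjM (GaugeField.plaqHol (faceSec V) p) (zeta R kz V ⟨p.src, p.ν⟩) =
      conjM (holAt V (walk y (word₄ p.src p.μ p.ν)))
        (∑ o : Orient P.d, ∑ k : Fin P.d → Fin (2 * R + 1),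
          ((kz p.ν (offs p.src) o k : ℝ) : ℂ) • wlogZ V (vadd y 0) o (kvec R k)) := by
    rw [plaqHol_faceSec_eq_holAt hj V p, zeta_eq_sum_wlogZ]
    have : vadd y 0 = y := by funext i; simp [vadd]
    rw [this]
  have hsplit : linZeta R kz V (faceSec V) p - rowForm R kz p.src p.μ p.ν (wlogZ V y) =
      (conjM (holAt V (walk y (optLetter (exb p.src p.μ) p.μ true)))
        (∑ o : Orient P.d, ∑ k : Fin P.d → Fin (2 * R + 1),
          ((kz p.ν (offs (p.src.shift p.μ)) o k : ℝ) : ℂ) • wlogZ V (vadd y (bvec (exb p.src p.μ) p.μ)) o (kvec R k)) -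
        ∑ o : Orient P.d, ∑ k : Fin P.d → Fin (2 * R + 1),
          ((kz p.ν (offs (p.src.shift p.μ)) o k : ℝ) : ℂ) • wlogZ V y o (bvec (exb p.src p.μ) p.μ + kvec R k)) -
      (conjM (holAt V (walk y (word₃ p.src p.μ p.ν)))
        (∑ o : Orient P.d, ∑ k : Fin P.d → Fin (2 * R + 1),
          ((kz p.μ (offs (p.src.shift p.ν)) o k : ℝ) : ℂ) • wlogZ V (vadd y (bvec (exb p.src p.ν) p.ν)) o (kvec R k)) -
        ∑ o : Orient P.d, ∑ k : Fin P.d → Fin (2 * R + 1),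
          ((kz p.μ (offs (p.src.shift p.ν)) o k : ℝ) : ℂ) • wlogZ V y o (bvec (exb p.src p.ν) p.ν + kvec R k)) -
      (conjM (holAt V (walk y (word₄ p.src p.μ p.ν)))
        (∑ o : Orient P.d, ∑ k : Fin P.d → Fin (2 * R + 1),
          ((kz p.ν (offs p.src) o k : ℝ) : ℂ) • wlogZ V (vadd y 0) o (kvec R k)) -
        ∑ o : Orient P.d, ∑ k : Fin P.d → Fin (2 * R + 1),
          ((kz p.ν (offs p.src) o k : ℝ) : ℂ) • wlogZ V y o (0 + kvec R k)) := by
    unfold linZeta rowForm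
    rw [e1, e2, e3, e4]
    simp only [zero_add]
    abel
  rw [hsplit]
  have hm2 := hK p.ν (offs (p.src.shift p.μ))
  have hm3 := hK p.μ (offs (p.src.shift p.ν))
  have hm4 := hK p.ν (offs p.src)
  calc _ ≤ ‖conjM (holAt V (walk y (optLetter (exb p.src p.μ) p.μ true)))
        (∑ o : Orient P.d, ∑ k : Fin P.d → Fin (2 * R + 1),
          ((kz p.ν (offs (p.src.shift p.μ)) o k : ℝ) : ℂ) • wlogZ V (vadd y (bvec (exb p.src p.μ) p.μ)) o (kvec R k)) -
        ∑ o : Orient P.d, ∑ k : Fin P.d → Fin (2 * R + 1),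
          ((kz p.ν (offs (p.src.shift p.μ)) o k : ℝ) : ℂ) • wlogZ V y o (bvec (exb p.src p.μ) p.μ + kvec R k)‖ +
      ‖conjM (holAt V (walk y (word₃ p.src p.μ p.ν)))
        (∑ o : Orient P.d, ∑ k : Fin P.d → Fin (2 * R + 1),
          ((kz p.μ (offs (p.src.shift p.ν)) o k : ℝ) : ℂ) • wlogZ V (vadd y (bvec (exb p.src p.ν) p.ν)) o (kvec R k)) -
        ∑ o : Orient P.d, ∑ k : Fin P.d → Fin (2 * R + 1),
          ((kz p.μ (offs (p.src.shift p.ν)) o k : ℝ) : ℂ) • wlogZ V y o (bvec (exb p.src p.ν) p.ν + kvec R k)‖ +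
      ‖conjM (holAt V (walk y (word₄ p.src p.μ p.ν)))
        (∑ o : Orient P.d, ∑ k : Fin P.d → Fin (2 * R + 1),
          ((kz p.ν (offs p.src) o k : ℝ) : ℂ) • wlogZ V (vadd y 0) o (kvec R k)) -
        ∑ o : Orient P.d, ∑ k : Fin P.d → Fin (2 * R + 1),
          ((kz p.ν (offs p.src) o k : ℝ) : ℂ) • wlogZ V y o (0 + kvec R k)‖ :=
        (norm_sub_le _ _).trans (add_le_add (norm_sub_le _ _) le_rfl)
    _ ≤ K₁ * unifB P R δ + K₁ * unifB P R δ + K₁ * unifB P R δ := by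
        refine add_le_add (add_le_add ?_ ?_) ?_
        · exact h2.trans (mul_le_mul_of_nonneg_right hm2 hU0)
        · exact h3.trans (mul_le_mul_of_nonneg_right hm3 hU0)
        · exact h4.trans (mul_le_mul_of_nonneg_right hm4 hU0)
    _ = 3 * K₁ * unifB P R δ := by ring

end RowForm

end Summit.QuantumFields.YangMills.Theorems.ApproxLift

end
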